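import Mathlib
import Summits.CriticalPhenomena.Ising3DConformalLimit.Theses.GaussianScaleMixture

/-!
# `GSMRigidity` (item stmt-CriticalPhenomena-8366): the swap-pencil circle lemma and jump positivity

Boundary / structure lemmas behind WHY the crux
`Summit.CriticalPhenomena.Ising3DConformalLimit.Theses.GaussianScaleMixture.GSMRigidity` resists
disproof (standing crux disprover, cycles 1–2, D-0016), split off the work file
`Summits/CriticalPhenomena/Ising3DConformalLimit/Cruxes/GSMRigidity/Disproof.lean` (findings F3, F8)
so that planners and provers can import them. None of them asserts a Theses statement.

The paper proof recorded in the work file reduces the crux to ONE complex variable: on the transverse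
momentum `q = k (e₁+e₂)/√2` (third component `0`) the swap-mirror pencil of every atom
`(ω·x²)^{-Δ}` of a Gaussian scale mixture is `c_ω a_ω^{-p} (t² - 2ρ_ω k t + k²)^{-p}`,
`p = 3/2 - Δ`, `ρ_ω = (ω₁-ω₂)/(ω₁+ω₂)`:

* `swapSlice_factor`, `swapSlice_rho_abs_lt_one`, `swapSlice_rho_eq_zero_iff` — the CIRCLE LEMMA:
  by Vieta all singularities of all atoms lie on the one circle `|t| = k`, at the angle
  `θ_ω = arccos ρ_ω`, on the Stieltjes cut (`θ = π/2`) exactly for the swap-symmetric atoms;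
  `swapSlice_factor_offplane` — off the plane (`k_w ≠ 0`) the root product `k² + k_w² τ_ω` depends on
  `ω`: there is no circle lemma there.
* `arcBase_eq`, `arcBase_eq'` — the PHASE LEMMA `(e^{iφ}-e^{iθ})(e^{iφ}-e^{-iθ}) = 2(cos φ - cos θ)e^{iφ}`:
  the monodromy jump of the pencil across the arc at `e^{iφ}` is
  `(e^{2πip}-1) e^{-ipχ(φ)} 2^{-p} ∫_{(0,φ)} (cos θ - cos φ)^{-p} dG(θ)` with ONE phase for all atoms.
* `jumpIntegrand_pos`, `measure_Ioo_eq_zero_of_jump_eq_zero`, `jump_positivity_of_frequently`,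
  `jump_positivity_ae`, `jump_positivity` — JUMP POSITIVITY: a measure on `ℝ` whose arc-jumps
  `∫⁻_{(0,φ)} (cos θ - cos φ)^{-p} dG` vanish for all / frequently-near-`π/2` / Lebesgue-a.e.
  `φ ∈ (0,π/2)` charges no angle in `(0, π/2)` — i.e. the mixing measure is carried by `{ω₁ = ω₂}`.
* `atom_pOne_partialFraction` — the endpoint `p = 1` (`Δ = 1/2`), where `e^{2πip} - 1 = 0`: the atom
  is a pole pair and the pencil a Cauchy transform on the circle (Plemelj jump instead of monodromy).

No definitions.
-/

noncomputable section

open scoped BigOperators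
open MeasureTheory Set

namespace Summit.CriticalPhenomena.Ising3DConformalLimit.Theorems.GSMRigidity.Negative

/-! ## The circle lemma -/

/-- **Circle lemma, algebraic core.** On the transverse momentum `q = k (e₁+e₂)/√2` the swap pencil
of the atom `ω` factors as `a_ω (t² - 2ρ_ω k t + k²)`, `a_ω = (1/ω₁ + 1/ω₂)/2`,
`ρ_ω = (ω₁ - ω₂)/(ω₁ + ω₂)`: by Vieta its two complex roots have product `k²`, i.e. lie ON the circle
`|t| = k`, whatever `ω` is. [folklore] -/
theorem swapSlice_factor {ω₁ ω₂ : ℝ} (h₁ : 0 < ω₁) (h₂ : 0 < ω₂) (k t : ℝ) :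
    (1 / ω₁ + 1 / ω₂) / 2 * t ^ 2 + (1 / ω₁ - 1 / ω₂) * (k * t) + (1 / ω₁ + 1 / ω₂) / 2 * k ^ 2 =
      (1 / ω₁ + 1 / ω₂) / 2 * (t ^ 2 - 2 * ((ω₁ - ω₂) / (ω₁ + ω₂)) * (k * t) + k ^ 2) := by
  have h12 : ω₁ + ω₂ ≠ 0 := by positivity
  field_simp
  ring

/-- `|ρ_ω| < 1` on the open simplex: the roots `k e^{±iθ_ω}`, `cos θ_ω = ρ_ω`, are off the real axis
for every atom. [folklore] -/
theorem swapSlice_rho_abs_lt_one {ω₁ ω₂ : ℝ} (h₁ : 0 < ω₁) (h₂ : 0 < ω₂) :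
    |(ω₁ - ω₂) / (ω₁ + ω₂)| < 1 := by
  rw [abs_div, abs_of_pos (by positivity : 0 < ω₁ + ω₂), div_lt_one (by positivity)]
  exact abs_sub_lt_iff.2 ⟨by linarith, by linarith⟩

/-- `ρ_ω = 0 ↔ ω₁ = ω₂`: the pencil singularities sit at `±ik` (on the Stieltjes cut) exactly for
the swap-symmetric atoms. [folklore] -/
theorem swapSlice_rho_eq_zero_iff {ω₁ ω₂ : ℝ} (h₁ : 0 < ω₁) (h₂ : 0 < ω₂) :
    (ω₁ - ω₂) / (ω₁ + ω₂) = 0 ↔ ω₁ = ω₂ := by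
  rw [div_eq_zero_iff, sub_eq_zero]
  constructor
  · rintro (h | h)
    · exact h
    · linarith
  · exact fun h => Or.inl h

/-- **No circle lemma off the plane.** At transverse momentum `(k, k_w)` the swap pencil of the
atom `ω` is `a_ω (t² - 2ρ_ω k t + k² + k_w² τ_ω)`, `τ_ω = 2ω₁ω₂/((ω₁+ω₂)ω₃)`: the root product
`k² + k_w² τ_ω` depends on `ω` unless `k_w = 0`, so inside/outside gluing says nothing there and a
proof must first reach the pencil `k_w = 0`. [folklore] -/
theorem swapSlice_factor_offplane {ω₁ ω₂ ω₃ : ℝ} (h₁ : 0 < ω₁) (h₂ : 0 < ω₂) (h₃ : 0 < ω₃)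
    (k kw t : ℝ) :
    (1 / ω₁ + 1 / ω₂) / 2 * t ^ 2 + (1 / ω₁ - 1 / ω₂) * (k * t) + (1 / ω₁ + 1 / ω₂) / 2 * k ^ 2 +
        kw ^ 2 / ω₃ =
      (1 / ω₁ + 1 / ω₂) / 2 *
        (t ^ 2 - 2 * ((ω₁ - ω₂) / (ω₁ + ω₂)) * (k * t) +
          (k ^ 2 + kw ^ 2 * (2 * ω₁ * ω₂ / ((ω₁ + ω₂) * ω₃)))) := by
  have h12 : ω₁ + ω₂ ≠ 0 := by positivity
  have h1 : ω₁ ≠ 0 := h₁.ne'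
  have h2 : ω₂ ≠ 0 := h₂.ne'
  have h3 : ω₃ ≠ 0 := h₃.ne'
  field_simp
  ring

/-! ## The phase lemma -/

/-- **Phase lemma: the base of the arc jump has a `θ`-independent argument.**
`(e^{iφ} - e^{iθ})(e^{iφ} - e^{-iθ}) = 2 (cos φ - cos θ) e^{iφ}`; for `θ < φ` the base is a negative
real multiple of `e^{iφ}`, so all atoms with `θ < φ` jump with one phase. [folklore] -/
theorem arcBase_eq (θ φ : ℝ) :
    (Complex.exp (φ * Complex.I) - Complex.exp (θ * Complex.I)) *
        (Complex.exp (φ * Complex.I) - Complex.exp (-(θ * Complex.I))) =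
      2 * ((Real.cos φ : ℂ) - Real.cos θ) * Complex.exp (φ * Complex.I) := by
  have hθ : Complex.exp (θ * Complex.I) * Complex.exp (-(θ * Complex.I)) = 1 := by
    rw [← Complex.exp_add, add_neg_cancel, Complex.exp_zero]
  have hφ : Complex.exp (-(φ * Complex.I)) * Complex.exp (φ * Complex.I) = 1 := by
    rw [← Complex.exp_add, neg_add_cancel, Complex.exp_zero]
  have cφ : (2 : ℂ) * Real.cos φ = Complex.exp (φ * Complex.I) + Complex.exp (-(φ * Complex.I)) := by
    rw [Complex.ofReal_cos, Complex.two_cos, neg_mul]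
  have cθ : (2 : ℂ) * Real.cos θ = Complex.exp (θ * Complex.I) + Complex.exp (-(θ * Complex.I)) := by
    rw [Complex.ofReal_cos, Complex.two_cos, neg_mul]
  have h2 : 2 * ((Real.cos φ : ℂ) - Real.cos θ) =
      (Complex.exp (φ * Complex.I) + Complex.exp (-(φ * Complex.I))) -
        (Complex.exp (θ * Complex.I) + Complex.exp (-(θ * Complex.I))) := by
    rw [mul_sub, cφ, cθ]
  rw [h2]
  linear_combination hθ - hφ

/-- Real form of the phase lemma: `e^{2iφ} - 2 cos θ e^{iφ} + 1 = 2(cos φ - cos θ) e^{iφ}`.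
[folklore] -/
theorem arcBase_eq' (θ φ : ℝ) :
    Complex.exp (φ * Complex.I) ^ 2 - 2 * Real.cos θ * Complex.exp (φ * Complex.I) + 1 =
      2 * ((Real.cos φ : ℂ) - Real.cos θ) * Complex.exp (φ * Complex.I) := by
  rw [← arcBase_eq]
  have hθ : Complex.exp (θ * Complex.I) * Complex.exp (-(θ * Complex.I)) = 1 := by
    rw [← Complex.exp_add, add_neg_cancel, Complex.exp_zero]
  have cθ : (2 : ℂ) * Real.cos θ = Complex.exp (θ * Complex.I) + Complex.exp (-(θ * Complex.I)) := by
    rw [Complex.ofReal_cos, Complex.two_cos, neg_mul]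
  linear_combination (-(Complex.exp (φ * Complex.I))) * cθ - hθ

/-- **The endpoint `p = 1` (`Δ = 1/2`)**, where the monodromy factor `e^{2πip} - 1` vanishes: the
atom is a pole pair, `1/((t-ζ)(t-ζ')) = (1/(t-ζ) - 1/(t-ζ'))/(ζ-ζ')`, and the pencil is a Cauchy
transform of a measure on the unit circle, killed on an arc of analyticity by the Plemelj jump.
[folklore] -/
theorem atom_pOne_partialFraction (t ζ ζ' : ℂ) (hne : ζ ≠ ζ') (ht : t ≠ ζ) (ht' : t ≠ ζ') :
    1 / ((t - ζ) * (t - ζ')) = (1 / (t - ζ) - 1 / (t - ζ')) / (ζ - ζ') := by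
  have h1 : t - ζ ≠ 0 := sub_ne_zero.2 ht
  have h2 : t - ζ' ≠ 0 := sub_ne_zero.2 ht'
  have h3 : ζ - ζ' ≠ 0 := sub_ne_zero.2 hne
  field_simp
  ring

/-! ## Jump positivity -/

/-- Positivity of the jump integrand: for `0 < θ < φ ≤ π`, `(cos θ - cos φ)^(-p) > 0`. [folklore] -/
theorem jumpIntegrand_pos {θ φ : ℝ} (hθ : 0 < θ) (hθφ : θ < φ) (hφ : φ ≤ Real.pi) (p : ℝ) :
    0 < (Real.cos θ - Real.cos φ) ^ (-p) :=
  Real.rpow_pos_of_pos (sub_pos.2 (Real.cos_lt_cos_of_nonneg_of_le_pi hθ.le hφ hθφ)) _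

/-- One vanishing arc-jump at angle `φ ∈ (0, π]` already empties `(0, φ)`. [folklore] -/
theorem measure_Ioo_eq_zero_of_jump_eq_zero {G : Measure ℝ} {p φ : ℝ} (hφ0 : 0 < φ)
    (hφπ : φ ≤ Real.pi)
    (h : ∫⁻ θ in Ioo 0 φ, ENNReal.ofReal ((Real.cos θ - Real.cos φ) ^ (-p)) ∂G = 0) :
    G (Ioo 0 φ) = 0 := by
  have _ := hφ0
  have hmeas : Measurable fun θ => ENNReal.ofReal ((Real.cos θ - Real.cos φ) ^ (-p)) :=
    ((Real.measurable_cos.sub measurable_const).pow_const _).ennreal_ofReal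
  have hae := (setLIntegral_eq_zero_iff measurableSet_Ioo hmeas).1 h
  rw [ae_iff] at hae
  refine measure_mono_null (fun θ hθ => ?_) hae
  simp only [Set.mem_setOf_eq]
  intro himp
  have hpos := jumpIntegrand_pos hθ.1 hθ.2 hφπ p
  exact (ENNReal.ofReal_pos.2 hpos).ne' (himp hθ)

/-- **Jump positivity, sharp form.** It suffices that the arc-jumps vanish on a set `D` of angles
accumulating at `π/2` from below. [folklore] -/
theorem jump_positivity_of_frequently {G : Measure ℝ} {p : ℝ} {D : Set ℝ}
    (hD : D ⊆ Ioo 0 (Real.pi / 2)) (hsup : ∀ ε > 0, ∃ φ ∈ D, Real.pi / 2 - ε < φ)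
    (h : ∀ φ ∈ D, ∫⁻ θ in Ioo 0 φ, ENNReal.ofReal ((Real.cos θ - Real.cos φ) ^ (-p)) ∂G = 0) :
    G (Ioo 0 (Real.pi / 2)) = 0 := by
  have hφ : ∀ φ ∈ D, G (Ioo 0 φ) = 0 := fun φ hφD =>
    measure_Ioo_eq_zero_of_jump_eq_zero (hD hφD).1 (by linarith [(hD hφD).2, Real.pi_pos]) (h φ hφD)
  choose φ hφD hφlt using fun n : ℕ => hsup (1 / ((n : ℝ) + 1)) (by positivity)
  have hcover : Ioo 0 (Real.pi / 2) ⊆ ⋃ n : ℕ, Ioo 0 (φ n) := by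
    intro x hx
    obtain ⟨n, hn⟩ := exists_nat_one_div_lt (sub_pos.2 hx.2)
    exact Set.mem_iUnion.2 ⟨n, hx.1, by linarith [hφlt n]⟩
  exact measure_mono_null hcover (measure_iUnion_null fun n => hφ _ (hφD n))

/-- **Jump positivity, a.e. form** (what the dominated radial limits deliver): if the arc-jump
vanishes for Lebesgue-a.e. `φ ∈ (0, π/2)` then `G (0, π/2) = 0`. [folklore] -/
theorem jump_positivity_ae {G : Measure ℝ} {p : ℝ}
    (h : ∀ᵐ φ ∂(volume : Measure ℝ), φ ∈ Ioo 0 (Real.pi / 2) →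
      ∫⁻ θ in Ioo 0 φ, ENNReal.ofReal ((Real.cos θ - Real.cos φ) ^ (-p)) ∂G = 0) :
    G (Ioo 0 (Real.pi / 2)) = 0 := by
  set D : Set ℝ := {φ | φ ∈ Ioo 0 (Real.pi / 2) ∧
    ∫⁻ θ in Ioo 0 φ, ENNReal.ofReal ((Real.cos θ - Real.cos φ) ^ (-p)) ∂G = 0} with hDdef
  refine jump_positivity_of_frequently (D := D) (fun φ hφ => hφ.1) ?_ (fun φ hφ => hφ.2)
  intro ε hε
  by_contra hne
  push Not at hne
  set ε' : ℝ := min ε (Real.pi / 2) with hε'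
  have hε'pos : 0 < ε' := lt_min hε (by positivity)
  have hε'le : ε' ≤ ε := min_le_left _ _
  have hε'le' : ε' ≤ Real.pi / 2 := min_le_right _ _
  rw [ae_iff] at h
  have hsub : Ioo (Real.pi / 2 - ε') (Real.pi / 2) ⊆
      {φ | ¬ (φ ∈ Ioo 0 (Real.pi / 2) →
        ∫⁻ θ in Ioo 0 φ, ENNReal.ofReal ((Real.cos θ - Real.cos φ) ^ (-p)) ∂G = 0)} := by
    intro φ hφ
    simp only [Set.mem_setOf_eq]
    intro himp
    have hφI : φ ∈ Ioo 0 (Real.pi / 2) := ⟨by linarith [hφ.1], hφ.2⟩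
    have hφD : φ ∈ D := ⟨hφI, himp hφI⟩
    have := hne φ hφD
    linarith [hφ.1]
  have hnull := measure_mono_null hsub h
  rw [Real.volume_Ioo] at hnull
  have : (0 : ENNReal) < ENNReal.ofReal (Real.pi / 2 - (Real.pi / 2 - ε')) :=
    ENNReal.ofReal_pos.2 (by linarith)
  exact this.ne' hnull

/-- **Jump positivity (the punchline).** If a measure `G` on `ℝ` (the push-forward of
`c_ω a_ω^{-p} Φ` to the angle `θ_ω = arccos ρ_ω`) has vanishing arc-jumps
`∫⁻_{(0,φ)} (cos θ - cos φ)^{-p} dG(θ) = 0` for every `φ ∈ (0, π/2)`, then `G (0, π/2) = 0`, i.e.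
`Φ{ω₁ > ω₂} = 0`: no cancellation is possible because the integrand is positive. [folklore] -/
theorem jump_positivity {G : Measure ℝ} {p : ℝ}
    (h : ∀ φ ∈ Ioo 0 (Real.pi / 2),
      ∫⁻ θ in Ioo 0 φ, ENNReal.ofReal ((Real.cos θ - Real.cos φ) ^ (-p)) ∂G = 0) :
    G (Ioo 0 (Real.pi / 2)) = 0 := by
  refine jump_positivity_of_frequently (D := Ioo 0 (Real.pi / 2)) subset_rfl (fun ε hε => ?_) h
  refine ⟨Real.pi / 2 - min ε (Real.pi / 2) / 2, ⟨?_, ?_⟩, ?_⟩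
  · have : min ε (Real.pi / 2) ≤ Real.pi / 2 := min_le_right _ _
    linarith [Real.pi_pos]
  · have : 0 < min ε (Real.pi / 2) := lt_min hε (by positivity)
    linarith
  · have : min ε (Real.pi / 2) ≤ ε := min_le_left _ _
    have : 0 < min ε (Real.pi / 2) := lt_min hε (by positivity)
    linarith

end Summit.CriticalPhenomena.Ising3DConformalLimit.Theorems.GSMRigidity.Negative
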